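import Summits.Ventures.PercRepro.RankLevelSetCircuitCount

/-!
# PercRepro — LEMMA T_k: THE CIRCUIT COUNT AT BOUNDED NULLITY UNDER LOCAL SPARSITY,
`#{circuits with k + 1 elements} ≤ 2^{t+k}·C(ν + k − 1, k)` (p9, S4)

`proofs/SUBCLAIM-S4-p9.md` §S4.2⁗. Night-1's `ncard_circuits_le_choose` (RankLevelSetCircuitCount) bounds the number of
`(k+1)`-circuits of a matroid of nullity `ν` by `C(ν + k, k + 1)` — sharp on `U_{k, ν+k}`, but one power of `ν` above
p2's Lemma T (`s₃ ≤ C(ν+1, 2)`) and Lemma T4 (`s₄ ≤ 2·C(ν+2, 3)`), which use the local sparsity of the `e`-free core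
(rank-`2` sets `≤ 3` points, rank-`3` sets `≤ 6` points). The same deletion / contraction induction, carried with a
SPARSITY DEPTH `t` — every rank-`j` set has `≤ 2^{j+t} − 1` points — gives the uniform statement: the circuits AVOIDING
a point `e` of some `(k+1)`-circuit are the `(k+1)`-circuits of `M ＼ {e}` (nullity `ν − 1`, the same depth `t`), the
circuits THROUGH `e` inject into the `k`-circuits of `M ／ {e}` (nullity `ν`, depth `t + 1`: a rank-`j` set `X` of
`M ／ {e}` has `r_M(X ∪ {e}) ≤ j + 1`, so `|X| + 2 ≤ 2^{j+1+t}`), and Pascal's rule adds up — with the loops handled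
directly (`≤ 2^t − 1`, all loops form a rank-`0` set). At depth `t = 0` (the `e`-free core, `ncard_add_one_le_two_pow_of_eRk_le`):

* **`ncard_circuits_le_two_pow_mul_choose_of_sparse`**: `#{C : |C| = k + 1} ≤ 2^{t+k}·C(ν + k − 1, k)`;
* **`ncard_circuits_le_two_pow_mul_choose_of_free`**: on the `e`-free core of nullity `d`, `s_k ≤ 2^{k−1}·C(d + k − 2, k − 1)`
  for every `k ≥ 1` — `s₃ ≤ 4·C(d+1, 2)`, `s₄ ≤ 8·C(d+2, 3)`, `s₅ ≤ 16·C(d+3, 4)`, … (Lemma T / T4 up to the constants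
  `4` / `4`; what matters for THEOREM P⁗′ is the exponent of `d`: `k − 1`, not `k`).
Axioms: standard.
-/

open scoped Matroid

namespace PercRepro

namespace Matroid

open Set

variable {α : Type} {M : _root_.Matroid α}

/-- **LEMMA T_k.** If `M` has nullity `ν` and every rank-`j` set has at most `2^{j+t} − 1` points (every `j`), then
`M` has at most `2^{t+k}·C(ν + k − 1, k)` circuits with `k + 1` elements. -/
theorem ncard_circuits_le_two_pow_mul_choose_of_sparse (M : _root_.Matroid α) [M.Finite] {ν : ℕ}
    (hν : M✶.eRank = (ν : ℕ∞)) (t : ℕ)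
    (hsp : ∀ j : ℕ, ∀ X ⊆ M.E, M.eRk X ≤ j → X.ncard + 1 ≤ 2 ^ (j + t)) (k : ℕ) :
    {C | M.IsCircuit C ∧ C.ncard = k + 1}.ncard ≤ 2 ^ (t + k) * (ν + k - 1).choose k := by
  suffices H : ∀ n : ℕ, ∀ (M : _root_.Matroid α) [M.Finite], M.E.ncard = n → ∀ (ν t k : ℕ),
      M✶.eRank = (ν : ℕ∞) → (∀ j : ℕ, ∀ X ⊆ M.E, M.eRk X ≤ j → X.ncard + 1 ≤ 2 ^ (j + t)) →
      {C | M.IsCircuit C ∧ C.ncard = k + 1}.ncard ≤ 2 ^ (t + k) * (ν + k - 1).choose k from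
    H _ M rfl ν t k hν hsp
  intro n
  induction n using Nat.strong_induction_on with
  | _ n ih =>
  intro M _ hn ν t k hν hsp
  classical
  set S := {C | M.IsCircuit C ∧ C.ncard = k + 1} with hS
  have hSfin : S.Finite := M.ground_finite.finite_subsets.subset (fun C hC => hC.1.subset_ground)
  -- `k = 0`: the `1`-circuits are the loops, a rank-`0` set of `≤ 2^t − 1` points
  rcases k with _ | k
  · set L := {x | x ∈ M.E ∧ M.IsLoop x} with hL
    have hLE : L ⊆ M.E := fun x hx => hx.1
    have hLr : M.eRk L ≤ 0 := by
      have h1 : L ⊆ M.closure ∅ := fun x hx => hx.2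
      calc M.eRk L ≤ M.eRk (M.closure ∅) := M.eRk_mono h1
        _ = M.eRk ∅ := M.eRk_closure_eq ∅
        _ = 0 := M.eRk_empty
    have hLcard := hsp 0 L hLE hLr
    have hsub : S ⊆ (fun x => ({x} : Set α)) '' L := by
      intro C hC
      obtain ⟨a, ha⟩ := ncard_eq_one.1 hC.2
      have hCa : M.IsCircuit {a} := ha ▸ hC.1
      have hloop : M.IsLoop a := _root_.Matroid.singleton_isCircuit.1 hCa
      have haE : a ∈ M.E := hCa.subset_ground (mem_singleton a)
      exact ⟨a, ⟨haE, hloop⟩, ha.symm⟩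
    have hLfin : L.Finite := M.ground_finite.subset hLE
    calc S.ncard ≤ ((fun x => ({x} : Set α)) '' L).ncard := ncard_le_ncard hsub (hLfin.image _)
      _ ≤ L.ncard := ncard_image_le hLfin
      _ ≤ 2 ^ (0 + t) := by omega
      _ = 2 ^ (t + 0) * (ν + 0 - 1).choose 0 := by simp
  -- `k + 1 ≥ 1`: deletion / contraction
  by_cases hSe : S = ∅
  · rw [hSe, ncard_empty]; exact Nat.zero_le _
  obtain ⟨C₀, hC₀⟩ := nonempty_iff_ne_empty.2 hSe
  obtain ⟨e, heC₀⟩ := hC₀.1.nonempty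
  have heE : e ∈ M.E := hC₀.1.subset_ground heC₀
  -- `e` lies in a circuit, so it is not a coloop: `M ＼ {e}` has nullity `ν − 1`
  have hne : ¬ M.IsColoop e := hC₀.1.not_isColoop_of_mem heC₀
  have hdel := dual_eRank_delete_singleton_add_one heE hne
  rw [hν] at hdel
  have hfin' : (M ＼ {e})✶.eRank ≠ ⊤ := by
    intro h
    rw [h] at hdel
    exact absurd hdel (by simp)
  obtain ⟨ν', hν'⟩ := ENat.ne_top_iff_exists.1 hfin'
  have hνν' : ν = ν' + 1 := by
    rw [← hν'] at hdel
    exact_mod_cast hdel.symm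
  have hdelE : (M ＼ {e}).E.ncard < n := by
    rw [_root_.Matroid.delete_ground, ← hn, ← ncard_sdiff_singleton_add_one heE M.ground_finite]
    omega
  -- `e` is not a loop (the circuit `C₀` through it has `≥ 2` elements)
  have heI : M.Indep {e} := by
    rw [_root_.Matroid.indep_singleton, ← _root_.Matroid.not_isLoop_iff heE]
    intro hloop
    have hC₀e : C₀ = {e} := hloop.eq_of_isCircuit_mem hC₀.1 heC₀
    have := hC₀.2
    rw [hC₀e, ncard_singleton] at this
    omega
  -- split the circuits by whether they contain `e`
  set S₁ := {C | M.IsCircuit C ∧ C.ncard = k + 1 + 1 ∧ e ∈ C} with hS₁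
  set S₂ := {C | M.IsCircuit C ∧ C.ncard = k + 1 + 1 ∧ e ∉ C} with hS₂
  have hsplit : S ⊆ S₁ ∪ S₂ := by
    intro C hC
    by_cases h : e ∈ C
    · exact Or.inl ⟨hC.1, hC.2, h⟩
    · exact Or.inr ⟨hC.1, hC.2, h⟩
  have hS₁fin : S₁.Finite := hSfin.subset (fun C hC => ⟨hC.1, hC.2.1⟩)
  have hS₂fin : S₂.Finite := hSfin.subset (fun C hC => ⟨hC.1, hC.2.1⟩)
  -- the circuits avoiding `e` are the `(k+2)`-circuits of `M ＼ {e}`, which keeps the depth `t`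
  have hspdel : ∀ j : ℕ, ∀ X ⊆ (M ＼ {e}).E, (M ＼ {e}).eRk X ≤ j → X.ncard + 1 ≤ 2 ^ (j + t) := by
    intro j X hX hr
    rw [_root_.Matroid.delete_ground] at hX
    rw [delete_singleton_eRk_eq hX] at hr
    exact hsp j X (hX.trans sdiff_subset) hr
  have h2 : S₂.ncard ≤ 2 ^ (t + (k + 1)) * (ν' + (k + 1) - 1).choose (k + 1) := by
    have hsub : S₂ ⊆ {C | (M ＼ {e}).IsCircuit C ∧ C.ncard = k + 1 + 1} := by
      intro C hC
      exact ⟨_root_.Matroid.delete_isCircuit_iff.2 ⟨hC.1, disjoint_singleton_right.2 hC.2.2⟩, hC.2.1⟩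
    calc S₂.ncard ≤ {C | (M ＼ {e}).IsCircuit C ∧ C.ncard = k + 1 + 1}.ncard :=
          ncard_le_ncard hsub
            ((M ＼ {e}).ground_finite.finite_subsets.subset (fun C hC => hC.1.subset_ground))
      _ ≤ 2 ^ (t + (k + 1)) * (ν' + (k + 1) - 1).choose (k + 1) :=
          ih _ hdelE (M ＼ {e}) rfl ν' t (k + 1) hν'.symm hspdel
  -- the circuits through `e` inject into the `(k+1)`-circuits of `M ／ {e}`, which has depth `t + 1`
  have hconE : (M ／ {e}).E.ncard < n := by
    rw [_root_.Matroid.contract_ground, ← hn, ← ncard_sdiff_singleton_add_one heE M.ground_finite]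
    omega
  have hνc : (M ／ {e})✶.eRank = (ν : ℕ∞) := by rw [dual_eRank_contract_singleton heI, hν]
  have hspcon : ∀ j : ℕ, ∀ X ⊆ (M ／ {e}).E, (M ／ {e}).eRk X ≤ j → X.ncard + 1 ≤ 2 ^ (j + (t + 1)) := by
    intro j X hX hr
    rw [_root_.Matroid.contract_ground] at hX
    have heX : e ∉ X := fun h => (hX h).2 rfl
    have hXfin : X.Finite := M.ground_finite.subset (hX.trans sdiff_subset)
    have h1 := contract_singleton_eRk_add_one heI hX
    have h2 : M.eRk (insert e X) ≤ ((j + 1 : ℕ) : ℕ∞) := by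
      rw [← h1]
      push_cast
      exact add_le_add_left hr 1
    have h3 := hsp (j + 1) (insert e X) (insert_subset heE (hX.trans sdiff_subset)) h2
    rw [ncard_insert_of_notMem heX hXfin] at h3
    rw [show j + (t + 1) = j + 1 + t by omega]
    omega
  have h1 : S₁.ncard ≤ 2 ^ (t + 1 + k) * (ν + k - 1).choose k := by
    let f : Set α → Set α := fun C => C \ {e}
    have hmaps : ∀ C ∈ S₁, f C ∈ {C' | (M ／ {e}).IsCircuit C' ∧ C'.ncard = k + 1} := by
      intro C hC
      have hCfin : C.Finite := M.ground_finite.subset hC.1.subset_ground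
      refine ⟨hC.1.contractElem_isCircuit ?_ hC.2.2, ?_⟩
      · have h1lt : 1 < C.ncard := by rw [hC.2.1]; omega
        obtain ⟨a, ha, b, hb, hab⟩ := (one_lt_ncard hCfin).1 h1lt
        exact ⟨a, ha, b, hb, hab⟩
      · have h3 := ncard_sdiff_singleton_add_one hC.2.2 hCfin
        have h4 := hC.2.1
        simp only [f]
        omega
    have hinj : InjOn f S₁ := by
      intro C hC C' hC' h
      have e1 : C = insert e (C \ {e}) := by rw [insert_sdiff_singleton, insert_eq_of_mem hC.2.2]
      have e2 : C' = insert e (C' \ {e}) := by rw [insert_sdiff_singleton, insert_eq_of_mem hC'.2.2]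
      rw [e1, e2]
      simp only [f] at h
      rw [h]
    calc S₁.ncard ≤ {C' | (M ／ {e}).IsCircuit C' ∧ C'.ncard = k + 1}.ncard :=
          ncard_le_ncard_of_injOn f hmaps hinj
            ((M ／ {e}).ground_finite.finite_subsets.subset (fun C hC => hC.1.subset_ground))
      _ ≤ 2 ^ (t + 1 + k) * (ν + k - 1).choose k := ih _ hconE (M ／ {e}) rfl ν (t + 1) k hνc hspcon
  -- Pascal
  have hP : (ν + k - 1).choose k + (ν' + (k + 1) - 1).choose (k + 1) = (ν + (k + 1) - 1).choose (k + 1) := by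
    rw [hνν', show ν' + 1 + k - 1 = ν' + k by omega, show ν' + (k + 1) - 1 = ν' + k by omega,
      show ν' + 1 + (k + 1) - 1 = ν' + k + 1 by omega]
    exact (Nat.choose_succ_succ' (ν' + k) k).symm
  have hpow : 2 ^ (t + 1 + k) = 2 ^ (t + (k + 1)) := by congr 1; omega
  calc S.ncard ≤ (S₁ ∪ S₂).ncard := ncard_le_ncard hsplit (hS₁fin.union hS₂fin)
    _ ≤ S₁.ncard + S₂.ncard := ncard_union_le _ _
    _ ≤ 2 ^ (t + 1 + k) * (ν + k - 1).choose k + 2 ^ (t + (k + 1)) * (ν' + (k + 1) - 1).choose (k + 1) :=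
        add_le_add h1 h2
    _ = 2 ^ (t + (k + 1)) * ((ν + k - 1).choose k + (ν' + (k + 1) - 1).choose (k + 1)) := by rw [hpow]; ring
    _ = 2 ^ (t + (k + 1)) * (ν + (k + 1) - 1).choose (k + 1) := by rw [hP]

/-- **LEMMA T_k ON THE `e`-FREE CORE** (depth `0`: rank-`j` sets have `≤ 2^j − 1` points): with `|E| = r(M) + d`,
for every `k ≥ 1`, `#{C : |C| = k} ≤ 2^{k−1}·C(d + k − 2, k − 1)`. -/
theorem ncard_circuits_le_two_pow_mul_choose_of_free (M : _root_.Matroid α) [M.Finite] {d : ℕ}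
    (hd : M.E.encard = M.eRank + d)
    (hsp : ∀ j : ℕ, ∀ X ⊆ M.E, M.eRk X ≤ j → X.ncard + 1 ≤ 2 ^ j) (k : ℕ) (hk : 1 ≤ k) :
    {C | M.IsCircuit C ∧ C.ncard = k}.ncard ≤ 2 ^ (k - 1) * (d + k - 2).choose (k - 1) := by
  have hν : M✶.eRank = (d : ℕ∞) := by
    have h := _root_.Matroid.eRank_add_eRank_dual M
    rw [hd] at h
    exact WithTop.add_left_cancel (eRank_ne_top_of_finite M) h
  have hsp0 : ∀ j : ℕ, ∀ X ⊆ M.E, M.eRk X ≤ j → X.ncard + 1 ≤ 2 ^ (j + 0) := by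
    intro j X hX hr
    rw [Nat.add_zero]
    exact hsp j X hX hr
  have := ncard_circuits_le_two_pow_mul_choose_of_sparse M hν 0 hsp0 (k - 1)
  rw [show k - 1 + 1 = k by omega, Nat.zero_add, show d + (k - 1) - 1 = d + k - 2 by omega] at this
  exact this

end Matroid

end PercRepro
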